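import Summits.Ventures.HodgeRepro2.T5SU11BorelHaar

/-!
# `borelHaar` is a Haar measure of `B = A N`, and `Δ_B(a_τ n_σ) = e^{2τ}` in Mathlib's vocabulary

The chart `ζ = s + i t ↦ a_t n_s` of `T5SU11BorelHaar` has the continuous inverse
`b ↦ (Im a(b) / (Re a(b) + Re b(b)), log (Re a(b) + Re b(b)))` (for `b = a_t n_s`:
`a(b) = cosh t + i s e^t`, `b(b) = sinh t - i s e^t`, so `Re a + Re b = e^t` and `Im a = s e^t`),
hence it is a HOMEOMORPHISM `ℂ ≃ₜ B` (`borelHomeomorph`). Consequently `borelHaar` is finite on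
compact sets and positive on open sets, i.e. **a (left) Haar measure of `B`**
(`instIsHaarMeasureBorelHaar`), and Mathlib's modular character of `B` is
`modularCharacterFun (a_τ n_σ) = e^{2τ}` (`modularCharacterFun_borelSubgroup`): the Borel subgroup
of `SU(1,1)` is not unimodular, with the classical modular function. Nothing is claimed about (N).

Blind lane: Mathlib + the HodgeRepro2 prefix only; no sorry; axioms ⊆ {propext, Classical.choice,
Quot.sound}.
-/

namespace Summit.Ventures.HodgeRepro2.T5SU11BorelHaarMeasure

open MeasureTheory MeasureTheory.Measure Metric Filter Topology Set Complex
open T5UnitaryBound T5PoincareDensity T5PoincareInvariance T5PoincareMeasure T5SU11Unimodular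
  T5SU11Fibration T5SU11FibrationHaar T5SU11Cartan T5SU11OneParameter T5BergmanCoefficient
  T5SU11HyperbolicSubgroup T5SU11UnipotentSubgroup T5SU11BorelSubgroup T5SU11Iwasawa
  T5SU11IwasawaUnique T5SU11BorelTransitive T5SU11IwasawaHaar T5SU11BorelHaar
open scoped ENNReal NNReal

/-! ### The matrix entries of `a_t n_s` and the inverse chart -/

/-- `b(a_t n_s) = sinh t - i s (cosh t + sinh t)`. -/
lemma mat_hyp_mul_unip_zero_one (t s : ℝ) :
    mat (hyp t * unip s) 0 1 =
      (Real.sinh t : ℂ) - (s : ℂ) * I * ((Real.cosh t : ℂ) + (Real.sinh t : ℂ)) := by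
  rw [mat_mul, mat_hyp, mat_unip, su11_mul]
  simp only [map_neg, map_mul, map_add, map_one, Complex.conj_ofReal, Complex.conj_I]
  show (Real.cosh t : ℂ) * -((s : ℂ) * I) + (Real.sinh t : ℂ) * (1 + (s : ℂ) * -I) = _
  ring

/-- `Re a(a_t n_s) + Re b(a_t n_s) = e^t`. -/
lemma re_add_re_hyp_mul_unip (t s : ℝ) :
    (mat (hyp t * unip s) 0 0).re + (mat (hyp t * unip s) 0 1).re = Real.exp t := by
  rw [mat_hyp_mul_unip_zero_zero, mat_hyp_mul_unip_zero_one]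
  simp only [Complex.add_re, Complex.sub_re, Complex.ofReal_re, Complex.mul_re, Complex.mul_im,
    Complex.ofReal_im, Complex.I_re, Complex.I_im, Complex.add_im]
  rw [Real.cosh_eq, Real.sinh_eq]
  ring

/-- `Im a(a_t n_s) = s e^t`. -/
lemma im_hyp_mul_unip (t s : ℝ) : (mat (hyp t * unip s) 0 0).im = s * Real.exp t := by
  rw [mat_hyp_mul_unip_zero_zero]
  simp only [Complex.add_im, Complex.ofReal_im, Complex.mul_im, Complex.mul_re, Complex.ofReal_re,
    Complex.I_re, Complex.I_im, Complex.add_re]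
  rw [Real.cosh_eq, Real.sinh_eq]
  ring

/-- `g ↦ b(g)` is continuous on `SU(1,1)`. -/
lemma continuous_mat_zero_one : Continuous fun g : SU11 => mat g 0 1 :=
  (continuous_apply 1).comp ((continuous_apply 0).comp
    (continuous_subtype_val.comp continuous_subtype_val))

/-- The `A`-coordinate `t = log (Re a(b) + Re b(b))` of `b = a_t n_s ∈ B`. -/
noncomputable def borelT (b : borelSubgroup) : ℝ :=
  Real.log ((mat (b : SU11) 0 0).re + (mat (b : SU11) 0 1).re)

/-- The `N`-coordinate `s = Im a(b) / (Re a(b) + Re b(b))` of `b = a_t n_s ∈ B`. -/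
noncomputable def borelS (b : borelSubgroup) : ℝ :=
  (mat (b : SU11) 0 0).im / ((mat (b : SU11) 0 0).re + (mat (b : SU11) 0 1).re)

/-- The inverse chart `b ↦ s + i t`. -/
noncomputable def borelCoordInv (b : borelSubgroup) : ℂ := ⟨borelS b, borelT b⟩

/-- `Re a(b) + Re b(b) > 0` on `B`. -/
lemma re_add_re_pos (b : borelSubgroup) : 0 < (mat (b : SU11) 0 0).re + (mat (b : SU11) 0 1).re := by
  obtain ⟨g, t, s, rfl⟩ := b
  simp only
  rw [re_add_re_hyp_mul_unip]
  exact Real.exp_pos t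

/-- `borelT (a_t n_s) = t`. -/
lemma borelT_borelCoordB (ζ : ℂ) : borelT (borelCoordB ζ) = ζ.im := by
  unfold borelT borelCoordB borelCoord
  simp only
  rw [re_add_re_hyp_mul_unip, Real.log_exp]

/-- `borelS (a_t n_s) = s`. -/
lemma borelS_borelCoordB (ζ : ℂ) : borelS (borelCoordB ζ) = ζ.re := by
  unfold borelS borelCoordB borelCoord
  simp only
  rw [re_add_re_hyp_mul_unip, im_hyp_mul_unip, mul_div_cancel_right₀ _ (Real.exp_pos _).ne']

/-- The inverse chart inverts the chart. -/
lemma borelCoordInv_borelCoordB (ζ : ℂ) : borelCoordInv (borelCoordB ζ) = ζ :=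
  Complex.ext (borelS_borelCoordB ζ) (borelT_borelCoordB ζ)

/-- The chart inverts the inverse chart. -/
lemma borelCoordB_borelCoordInv (b : borelSubgroup) : borelCoordB (borelCoordInv b) = b := by
  obtain ⟨ζ, rfl⟩ : ∃ ζ, borelCoordB ζ = b := by
    obtain ⟨g, t, s, rfl⟩ := b
    exact ⟨⟨s, t⟩, rfl⟩
  rw [borelCoordInv_borelCoordB]

/-- The inverse chart is continuous. -/
lemma continuous_borelCoordInv : Continuous borelCoordInv := by
  have h00 : Continuous fun b : borelSubgroup => mat (b : SU11) 0 0 :=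
    T5SU11UnipotentSubgroup.continuous_mat_zero_zero.comp continuous_subtype_val
  have h01 : Continuous fun b : borelSubgroup => mat (b : SU11) 0 1 :=
    continuous_mat_zero_one.comp continuous_subtype_val
  have hsum : Continuous fun b : borelSubgroup =>
      (mat (b : SU11) 0 0).re + (mat (b : SU11) 0 1).re :=
    (Complex.continuous_re.comp h00).add (Complex.continuous_re.comp h01)
  have hne : ∀ b : borelSubgroup, (mat (b : SU11) 0 0).re + (mat (b : SU11) 0 1).re ≠ 0 :=
    fun b => (re_add_re_pos b).ne'
  have hT : Continuous borelT :=
    Real.continuousOn_log.comp_continuous hsum fun b => hne b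
  have hS : Continuous borelS := (Complex.continuous_im.comp h00).div hsum hne
  have e : borelCoordInv = fun b => (borelS b : ℂ) + (borelT b : ℂ) * I := by
    funext b
    apply Complex.ext <;> simp [borelCoordInv]
  rw [e]
  exact (Complex.continuous_ofReal.comp hS).add ((Complex.continuous_ofReal.comp hT).mul continuous_const)

/-- **The chart is a homeomorphism `ℂ ≃ₜ B`.** -/
noncomputable def borelHomeomorph : ℂ ≃ₜ borelSubgroup where
  toFun := borelCoordB
  invFun := borelCoordInv
  left_inv := borelCoordInv_borelCoordB
  right_inv := borelCoordB_borelCoordInv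
  continuous_toFun := continuous_borelCoordB
  continuous_invFun := continuous_borelCoordInv

/-- `borelHomeomorph` is the chart. -/
lemma coe_borelHomeomorph : ⇑borelHomeomorph = borelCoordB := rfl

/-! ### `borelHaar` is a Haar measure -/

/-- `B` is locally compact (homeomorphic to `ℂ`). -/
instance instLocallyCompactSpaceBorelSubgroup : LocallyCompactSpace borelSubgroup :=
  borelHomeomorph.locallyCompactSpace_iff.1 inferInstance

/-- `B` is second countable (homeomorphic to `ℂ`). -/
instance instSecondCountableTopologyBorelSubgroup : SecondCountableTopology borelSubgroup :=
  borelHomeomorph.symm.secondCountableTopology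

/-- `borelHaar` is finite on compact sets. -/
instance instIsFiniteMeasureOnCompactsBorelHaar : IsFiniteMeasureOnCompacts borelHaar := by
  refine ⟨fun K hK => ?_⟩
  unfold borelHaar
  rw [measurableEmbedding_borelCoordB.map_apply]
  have hK' : IsCompact (borelCoordB ⁻¹' K) := by
    rw [← coe_borelHomeomorph]
    exact borelHomeomorph.isCompact_preimage.2 hK
  exact hK'.measure_lt_top

/-- `borelHaar` is positive on non-empty open sets. -/
instance instIsOpenPosMeasureBorelHaar : IsOpenPosMeasure borelHaar := by
  refine ⟨fun U hU hne => ?_⟩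
  unfold borelHaar
  rw [measurableEmbedding_borelCoordB.map_apply]
  have hU' : IsOpen (borelCoordB ⁻¹' U) := hU.preimage continuous_borelCoordB
  have hne' : (borelCoordB ⁻¹' U).Nonempty := by
    obtain ⟨b, hb⟩ := hne
    exact ⟨borelCoordInv b, by rw [Set.mem_preimage, borelCoordB_borelCoordInv]; exact hb⟩
  exact (hU'.measure_pos volume hne').ne'

/-- **`borelHaar` is a Haar measure of the Borel subgroup `B = A N`.** -/
instance instIsHaarMeasureBorelHaar : IsHaarMeasure borelHaar where
  toIsMulLeftInvariant := isMulLeftInvariant_borelHaar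

/-! ### The modular function of `B` -/

/-- **The modular function of `B = A N`**: `Δ_B(a_τ n_σ) = e^{2τ}` (Mathlib's `modularCharacterFun`,
computed on the Haar measure `borelHaar` through `T5SU11BorelHaar.map_mul_right_borelHaar`). -/
theorem modularCharacterFun_borelSubgroup (τ σ : ℝ) (hb : hyp τ * unip σ ∈ borelSubgroup) :
    modularCharacterFun (⟨hyp τ * unip σ, hb⟩ : borelSubgroup) = Real.toNNReal (Real.exp (2 * τ)) := by
  set b : borelSubgroup := ⟨hyp τ * unip σ, hb⟩ with hbdef
  set k := haarScalarFactor (Measure.map (· * b) borelHaar) borelHaar with hk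
  have h1 : modularCharacterFun b = k := modularCharacterFun_eq_haarScalarFactor borelHaar b
  have h2 : Measure.map (· * b) borelHaar = k • borelHaar := isMulLeftInvariant_eq_smul _ _
  have h3 : Measure.map (· * b) borelHaar = ENNReal.ofReal (Real.exp (2 * τ)) • borelHaar :=
    map_mul_right_borelHaar τ σ hb
  have hS := congrArg (fun μ : Measure borelSubgroup => μ (borelCoordB '' ball (0 : ℂ) 1))
    (h2.symm.trans h3)
  simp only [Measure.smul_apply, ENNReal.smul_def, smul_eq_mul, borelHaar_image_ball] at hS
  have hpos : volume (ball (0 : ℂ) 1) ≠ 0 := (Metric.measure_ball_pos volume (0 : ℂ) one_pos).ne'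
  have hfin : volume (ball (0 : ℂ) 1) ≠ ∞ := measure_ball_lt_top.ne
  have hk' : (k : ℝ≥0∞) = ENNReal.ofReal (Real.exp (2 * τ)) := (ENNReal.mul_left_inj hpos hfin).1 hS
  rw [h1]
  exact ENNReal.coe_injective hk'

/-- `Δ_B(a_τ n_σ) = e^{2τ}` as a real number. -/
theorem coe_modularCharacterFun_borelSubgroup (τ σ : ℝ) (hb : hyp τ * unip σ ∈ borelSubgroup) :
    (modularCharacterFun (⟨hyp τ * unip σ, hb⟩ : borelSubgroup) : ℝ) = Real.exp (2 * τ) := by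
  rw [modularCharacterFun_borelSubgroup, Real.coe_toNNReal _ (Real.exp_pos _).le]

/-- **`B` is not unimodular**: `Δ_B(a_1) = e² ≠ 1`. -/
theorem modularCharacterFun_ne_one :
    modularCharacterFun (⟨hyp 1 * unip 0, hyp_mul_unip_mem_borelSubgroup 1 0⟩ : borelSubgroup) ≠ 1 := by
  intro h
  have h' := congrArg (fun x : ℝ≥0 => (x : ℝ)) h
  rw [coe_modularCharacterFun_borelSubgroup, NNReal.coe_one] at h'
  have : Real.exp 0 < Real.exp (2 * 1) := Real.exp_lt_exp.2 (by norm_num)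
  rw [Real.exp_zero] at this
  linarith

end Summit.Ventures.HodgeRepro2.T5SU11BorelHaarMeasure
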